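import Summits.AtomisticToContinuum.Crystallization.Theorems.FrustratedLawDichotomyCellF1NashRow
import Summits.AtomisticToContinuum.Crystallization.Theorems.FrustratedLawDichotomyCellF1cSymm

/-!
# FrustratedLawDichotomy · crux `AperiodicFrustratedLawGap` (stmt-AtomisticToContinuum-27623) — class-A K-file tower, layer 2h-c:
ROOT-CENTRED NEAR LISTS of the COMPLETE template coincide with the old ones, and the NASH row on the named column (KFILE amendment E4 «MI/MN/ML
identical», critic r1861; decomp-a2c hand-2 g48)

The (251) master's near lists are root-centred integer balls: `MN ⊇ {m ≠ o : |z m|² < ℓ_N}`, `ML ⊇ {m ≠ o : |z m|² < ℓ_D}` (dials of record `ℓ_N = 63`,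
`ℓ_D = 23`).  Amendment E changed the ambient label set `MF1 ↦ MF1c` but — as E4 says — not these lists.  Here that is a THEOREM:
* `ballL_M_subset_Mc` (monotonicity in the label set) and `qk_le_of_sqT` (`qk z ≤ 137 030 436·|z|²`, the larger diagonal entry of `AF1`);
* ★ `ballL_Mc_root_eq` — for EVERY radius `ℓ ≤ 330`, `ballL MF1c zT ℓ 0 = ballL MF1 zT ℓ 0` (a parity label with `|z|² < ℓ ≤ 330` has `qk ≤ 137 030 436·330 ≤ BL`,
  hence is an old label); so every root-centred column of the ed-2 tower (NASH list `MN`, debit list `ML`, their readings and folds #100 …) transfers to the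
  complete template VERBATIM at the dials of record, and `(ballL MF1c zT ℓ 0).erase 0 = (ballL MF1 zT ℓ 0).erase 0`;
* ★ `nn_of_reps_aF1c` — #94's NASH row from representatives on the named column `aF1`, over `MF1c` (near list `nb := ballL MF1c zT ℓn`).
Imports TREE #94 `…CellF1NashRow` + #115 `…CellF1cSymm`; 0 sorry.  Tags: [new: K-file layer]; nothing here closes an item.
-/

namespace Summit.AtomisticToContinuum.Crystallization.Theorems.FrustratedLawDichotomyCellF1cNear

open scoped BigOperators RealInnerProductSpace
open Summit.AtomisticToContinuum.Crystallization.Theorems.ChargedEnergyGapNegative (E3)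
open Summit.AtomisticToContinuum.Crystallization.Theorems.FrustratedLawDichotomyCoherentFloorAlgebra (psiT)
open Summit.AtomisticToContinuum.Crystallization.Theorems.FrustratedLawDichotomyCellTails (certCoeffNearL)
open Summit.AtomisticToContinuum.Crystallization.Theorems.FrustratedLawDichotomyCellMetric (posL)
open Summit.AtomisticToContinuum.Crystallization.Theorems.FrustratedLawDichotomyCellClasses (ballL)
open Summit.AtomisticToContinuum.Crystallization.Theorems.FrustratedLawDichotomyCellTriples (zT sqT subT mem_ballL_zT)
open Summit.AtomisticToContinuum.Crystallization.Theorems.FrustratedLawDichotomyCellSymm (nn_of_reps)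
open Summit.AtomisticToContinuum.Crystallization.Theorems.FrustratedLawDichotomyCellSymmZ3 (actZ)
open Summit.AtomisticToContinuum.Crystallization.Theorems.FrustratedLawDichotomyCellStab16 (RZ Rr rep16 symOf16 act_inj)
open Summit.AtomisticToContinuum.Crystallization.Theorems.FrustratedLawDichotomyCellF1Frame (qk qk_eq BL admL_iff)
open Summit.AtomisticToContinuum.Crystallization.Theorems.FrustratedLawDichotomyCellF1Labels (MF1 MIF1 mem_M hMI)
open Summit.AtomisticToContinuum.Crystallization.Theorems.FrustratedLawDichotomyCellF1cLabels (MF1c admLc_iff mem_Mc M_subset_Mc MI_subset_Mc hMc)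
open Summit.AtomisticToContinuum.Crystallization.Theorems.FrustratedLawDichotomyCellF1Symm (BF1 hB_F1)
open Summit.AtomisticToContinuum.Crystallization.Theorems.FrustratedLawDichotomyCellF1Reps (hcov_of_subset)
open Summit.AtomisticToContinuum.Crystallization.Theorems.FrustratedLawDichotomyCellF1Pos (aF1 aF1_eq)
open Summit.AtomisticToContinuum.Crystallization.Theorems.FrustratedLawDichotomyCellF1cSymm (hnb_F1c)

/-! ## §1 Root-centred near lists do not see the collar -/

/-- near lists are monotone in the ambient label set: `ballL MF1 zT ℓ c ⊆ ballL MF1c zT ℓ c`. -/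
theorem ballL_M_subset_Mc (ℓ : ℤ) (c : ℤ × ℤ × ℤ) : ballL MF1 zT ℓ c ⊆ ballL MF1c zT ℓ c := by
  intro x hx
  rw [mem_ballL_zT] at hx ⊢
  exact ⟨M_subset_Mc hx.1, hx.2⟩

/-- the class key is dominated by the integer squared length: `qk z ≤ 137 030 436·|z|²` (the larger diagonal entry of `AF1`). -/
theorem qk_le_of_sqT (z : ℤ × ℤ × ℤ) : qk z ≤ 137030436 * sqT z := by
  rw [qk_eq]; unfold sqT
  nlinarith [mul_self_nonneg z.1, sq_nonneg z.1, sq_nonneg z.2.1, sq_nonneg z.2.2]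

/-- the integer squared length about the root is `sqT`. -/
theorem sqT_subT_zero (x : ℤ × ℤ × ℤ) : sqT (subT x 0) = sqT x := by
  simp [sqT, subT]

/-- ★ ROOT-CENTRED NEAR LISTS COINCIDE for every radius `ℓ ≤ 330`: a complete label within `ℓ` of the root is an old label. -/
theorem ballL_Mc_root_eq {ℓ : ℤ} (hℓ : ℓ ≤ 330) : ballL MF1c zT ℓ (0 : ℤ × ℤ × ℤ) = ballL MF1 zT ℓ (0 : ℤ × ℤ × ℤ) := by
  refine Finset.Subset.antisymm ?_ (ballL_M_subset_Mc ℓ 0)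
  intro x hx
  rw [mem_ballL_zT] at hx ⊢
  refine ⟨?_, hx.2⟩
  have hpar := ((admLc_iff x).mp (mem_Mc.mp hx.1)).1
  have hs : sqT x < ℓ := by rw [← sqT_subT_zero]; exact hx.2
  have hq := qk_le_of_sqT x
  refine mem_M.mpr ((admL_iff x).mpr ⟨hpar, ?_⟩)
  unfold BL
  nlinarith

/-- the punctured root-centred lists coincide likewise (`MN := (ballL M zT ℓ_N 0).erase 0`, `ML := (ballL M zT ℓ_D 0).erase 0`). -/
theorem ballL_Mc_root_erase_eq {ℓ : ℤ} (hℓ : ℓ ≤ 330) :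
    (ballL MF1c zT ℓ (0 : ℤ × ℤ × ℤ)).erase 0 = (ballL MF1 zT ℓ (0 : ℤ × ℤ × ℤ)).erase 0 := by
  rw [ballL_Mc_root_eq hℓ]

/-- the dials of record are covered: `ℓ_N = 63`, `ℓ_D = 23` (and any dial up to `330`). -/
theorem dials_le : (63 : ℤ) ≤ 330 ∧ (23 : ℤ) ≤ 330 := by norm_num

/-! ## §2 The NASH row on the named column over the complete template -/

/-- (ha) template equivariance on the named column over `MF1c`. -/
theorem ha_aF1c : ∀ k : Fin 16, ∀ x ∈ MF1c, aF1 (actZ (RZ k) x) = (Rr k).mulVec (aF1 x) :=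
  fun k x _ => Summit.AtomisticToContinuum.Crystallization.Theorems.FrustratedLawDichotomyCellF1Pos.aF1_act k x

/-- ★ THE F1 NASH ROW FROM REPRESENTATIVES on the named column `aF1` over the COMPLETE template (rule G5): near list `nb := ballL MF1c zT ℓn`, multiplier
column `ω` a binder. -/
theorem nn_of_reps_aF1c (ω : ℤ × ℤ × ℤ → Fin 3 → ℝ) (hω : ∀ k : Fin 16, ∀ x ∈ MIF1, ω (actZ (RZ k) x) = (Rr k).mulVec (ω x))
    (ℓn : ℤ) {MN Reps : Finset (ℤ × ℤ × ℤ)} (hReps : Reps ⊆ MF1c) (hR : ∀ m ∈ MN, rep16 m ∈ Reps) (nnTab : ℤ × ℤ × ℤ → ℝ)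
    (hrep : ∀ F ∈ BF1, ∀ m₀ ∈ Reps, ‖psiT (‖posL F (aF1 m₀)‖ ^ 2) • posL F (aF1 m₀)
        - certCoeffNearL MF1c MIF1 (fun x => posL F (aF1 x)) (fun x => posL F (ω x)) (ballL MF1c zT ℓn) m₀‖ ≤ nnTab m₀) :
    ∀ F ∈ BF1, ∀ m ∈ MN, ‖psiT (‖posL F (aF1 m)‖ ^ 2) • posL F (aF1 m)
        - certCoeffNearL MF1c MIF1 (fun x => posL F (aF1 x)) (fun x => posL F (ω x)) (ballL MF1c zT ℓn) m‖ ≤ nnTab (rep16 m) :=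
  nn_of_reps (B := BF1) (Rr := Rr) (Pk := fun k => actZ (RZ k)) (a := aF1) (ω := ω) (symOf := symOf16)
    hB_F1 act_inj hMc hMI MI_subset_Mc (hnb_F1c ℓn) ha_aF1c hω hReps (hcov_of_subset hR) nnTab hrep

end Summit.AtomisticToContinuum.Crystallization.Theorems.FrustratedLawDichotomyCellF1cNear
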